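import Literature.Computability.AlgebraicComplexity.BI17PowerSumDegreeProofs
import Literature.Computability.AlgebraicComplexity.PlethysmStability
import Literature.NumberTheory.DiophantineGeometry.KroneckerRectangularStability
import HarnessLib

/-!
# Odd inner degree: plethysm highest-weight vectors need distinct column sets
# (BI 2017 App. Prop. 7.1 / Cor. 7.2, the vanishing case), and Prop. 3.24 discharged

Topic `Literature/Computability/AlgebraicComplexity`; theorems only (no definitions, no named facts).
Continues `PlethysmStability.lean` / `PlethysmLengthVanishing.lean` (their conventions: the word
model `wordRep k N (D m)` of `V^{⊗ Dm}`, `V = k^N`, positions `Fin (D * m)` in `D` blocks of size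
`m` (`blockIdx`), the wreath product `S_D ≀ S_m = blockPerms D m` and its symmetriser
`Σ = blockSymmetrizer k D m`, standard fillings `T : StdFilling (D m) Y` and their polytabloids
`e_T`; BIP Prop. 3.3 / (4.1): the wreath-invariant highest-weight vectors of weight `λ` — counted by
the plethysm coefficient `a_λ(D[m])` — are spanned by the `Σ e_T`) and `BI17PowerSumDegreeProofs.lean`
(BI 2017 Prop. 3.24 (1)(2)).

## Results

1. **Equal column sets kill `Σ e_T` when the block size `m` is odd**
   (`StdFilling.blockSymmetrizer_polytabloid_eq_zero_of_colset_eq`): if two blocks `r ≠ r'` meet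
   every column at most once and occupy the same set of `m` columns, then the block permutation
   exchanging them column by column lies in the column stabiliser of `T` with sign `(-1)^m = -1`,
   so `Σ e_T = -Σ e_T = 0`. This is the mechanism behind the "SETS of cardinality-`D` subsets" in
   P. Bürgisser, C. Ikenmeyer, *Fundamental invariants of orbit closures*, J. Algebra 477 (2017),
   Appendix Prop. 7.1 / Cor. 7.2 (arXiv §7, L2871–2900; there via `Sym^d Sym^D ↔ ∧^d ∧^D` for odd
   `D`, Manivel–Michałek Fact 6.1): a repeated subset contributes nothing.
2. **The vanishing case of Cor. 7.2** (`eq_zero_of_mem_highestWeightSpace_wordRep_of_choose_lt`,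
   `eq_zero_of_mem_highestWeightSpace_coordRep_of_choose_lt`): if all cells of `Y` lie in columns
   `< C` and `binom(C, m) < D`, no standard filling has `D` pairwise distinct column-injective
   blocks (pigeonhole), so every wreath-invariant highest-weight vector of weight `Y` vanishes
   (BIP Lemma 4.3(1) for the other fillings); transported to `k[Sym^n (k^σ)]_d` by the polarisation
   dictionary `wordOfForm` of `PlethysmStability.lean` §5: no highest-weight vector of the dual
   weight `λ^*` in degree `d` when `n` is odd and `binom(λ_1, n) < d`.
3. **`SL_m`-invariants are highest-weight vectors of rectangular weight**
   (`slInvariantsOfDegree_le_highestWeightSpace`): a homogeneous `SL_m`-invariant of degree `d` on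
   `Sym^D ℂ^m` is a highest-weight vector of `coordRep` of the constant weight `-(Dd/m)`
   (`GL_m = ℂ^× SL_m`, `exists_eq_scalar_mul_toGL`). Hence (`slInvariantsOfDegree_eq_bot_of_choose_lt`)
   **`O(Sym^D ℂ^m)^{SL_m}_d = 0` for `D` odd, `m ∣ Dd` and `binom(Dd/m, D) < d`** — the case of
   Cor. 7.2 in which the printed bound is `0` ("It suffices to show that there are less than `2m`
   distinct cardinality `D` subsets", proof of Prop. 3.24(3), L1392).
4. **BI 2017 Prop. 3.24 discharged** (`BI2017_prop_3_24_part3`, `BI2017_prop_3_24_holds`): with 3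
   at `d = 2m`, `Dd/m = 2D`, part (3) of Prop. 3.24 is unconditional, and together with
   `BI2017_prop_3_24_part1/2` the named fact `BI2017_prop_3_24` holds.

Honest framing (cell `val-lit`, rung V3): a discharge of a typed literature fact over proved tree
theorems; nothing here bears on VP versus VNP.

## References

* [BurgisserIkenmeyer2017] P. Bürgisser, C. Ikenmeyer, *Fundamental invariants of orbit closures*,
  J. Algebra 477 (2017) 390–434 = arXiv:1511.02927: Prop. 3.24 (L1315) and its proof (L1330–1395),
  Appendix Prop. 7.1 / Cor. 7.2 (L2871–2900).
* [BurgisserIkenmeyerPanovaJAMS2019] P. Bürgisser, C. Ikenmeyer, G. Panova, J. AMS 32 (2019) =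
  arXiv:1604.06431v3: Prop. 3.3, (4.1), Lemma 4.3(1) (the word model of the plethysm).

## Tree

`blockIdx`, `blockPerms`, `mem_blockPerms`, `blockSymmetrizer`, `blockSymmetrizer_wordPerm`,
`blockSymmetrizer_apply_of_forall_wordPerm_eq`, `blockPermsFinset`, `card_blockPermsFinset_pos`,
`exists_sum_smul_polytabloid_eq`, `StdFilling.blockSymmetrizer_polytabloid_eq_zero`,
`StdFilling.wordPerm_polytabloid_of_mem_colStab`, `wordOfForm`, `wordOfForm_mem_highestWeightSpace`,
`wordPerm_wordOfForm`, `eq_of_wordOfForm_eq`, `wordOfForm_apply`, `polarize` (`PlethysmStability`);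
`StdFilling`, `StdFilling.mem`, `StdFilling.injective`, `StdFilling.colStab`, `StdFilling.mem_colStab`,
`ydWeight_youngDiagram`, `fst_lt_of_mem_youngDiagram`, `Nat.Partition.card_cells_youngDiagram`
(`StandardFillings`, `SchurWeylPlethysmHwMultiplicityProofs`, `PartitionTableaux`);
`mem_youngDiagram_rectangle_iff`, `Weight.ofPartition_rectangle_apply`,
`Nat.Partition.card_parts_rectangle_le` (`KroneckerRectangularStability`,
`SchurWeylPlethysmKroneckerBoundProofs`); `exists_eq_scalar_mul_toGL`,
`coordSubst_scalar_mul_toGL_of_isHomogeneous` (`BI17DegreeExponentMonoidProofs`);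
`BI2017_prop_3_24_part1`, `BI2017_prop_3_24_part2`, `degreePeriod_psum_of_odd`
(`BI17PowerSumDegreeProofs`); `BI2017_lem_3_2_3_holds`, `degreePeriod_dvd_of_mem_degreeMonoid`,
`exists_pos_mem_degreeMonoid`, `BI2017_cor_2_9_chow_powerSum_holds`. Mathlib: `Equiv.permCongr`,
`Equiv.prodCongrLeft/Right`, `Equiv.Perm.sign_permCongr`, `Equiv.Perm.sign_prodCongrLeft`,
`Finset.card_powersetCard`, `Fin.revPerm`.
-/

noncomputable section

open scoped BigOperators

namespace Literature.Computability.AlgebraicComplexity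

open _root_.Literature.NumberTheory.DiophantineGeometry

/-! ### §1 Word model: equal column sets of two blocks kill `Σ e_T` (odd block size) -/

section WordModel

variable {k : Type*} [Field k] [CharZero k] {N D m : ℕ} {Y : YoungDiagram}

/-- **Two column-injective blocks with the same column set kill `Σ e_T` when the block size is
odd.** Let `T` be a standard filling of `Y` by the `D m` positions such that no column contains
two positions of one block, and let `r ≠ r'` be blocks such that every column met by block `r` is
met by block `r'`. Then the block permutation exchanging `r` and `r'` column by column lies in the
wreath product and in the column stabiliser of `T`, with sign `(-1)^m`; for odd `m`,
`Σ e_T = Σ (g · e_T) = -Σ e_T`, so `Σ e_T = 0` (characteristic zero). This is why only SETS of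
`D`-subsets count in BI 2017 App. Prop. 7.1 ("`∧^d ∧^D`").
[cite: BurgisserIkenmeyer2017, §7 (Appendix) Prop. 7.1 (proof)] -/
theorem _root_.Literature.NumberTheory.DiophantineGeometry.StdFilling.blockSymmetrizer_polytabloid_eq_zero_of_colset_eq
    (hN : ∀ x ∈ Y.cells, x.1 < N) (T : StdFilling (D * m) Y) (hm : Odd m)
    (hinj : ∀ p q : Fin (D * m), (T.1 p).2 = (T.1 q).2 → blockIdx D m p = blockIdx D m q → p = q)
    {r r' : Fin D} (hrr' : r ≠ r')
    (hcol : ∀ p : Fin m, ∃ p' : Fin m,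
      (T.1 (finProdFinEquiv (r', p'))).2 = (T.1 (finProdFinEquiv (r, p))).2) :
    blockSymmetrizer k D m (T.polytabloid k hN) = 0 := by
  classical
  -- the column-matching bijection `ψ` from block `r` to block `r'`
  choose φ hφ using hcol
  have hφinj : Function.Injective φ := by
    intro p₁ p₂ h
    have hc : (T.1 (finProdFinEquiv (r, p₁))).2 = (T.1 (finProdFinEquiv (r, p₂))).2 := by
      rw [← hφ p₁, ← hφ p₂, h]
    have := hinj _ _ hc (by rw [blockIdx_finProdFinEquiv, blockIdx_finProdFinEquiv])
    exact (Prod.ext_iff.mp (finProdFinEquiv.injective this)).2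
  let ψ : Equiv.Perm (Fin m) := Equiv.ofBijective φ (Finite.injective_iff_bijective.mp hφinj)
  have hψ : ∀ p, ψ p = φ p := fun _ => rfl
  -- the exchange `G` of the two blocks on `Fin D × Fin m`, as a conjugate of `(r r') × id`
  let P : Equiv.Perm (Fin D × Fin m) := Equiv.prodCongrLeft fun _ : Fin m => Equiv.swap r r'
  let C : Equiv.Perm (Fin D × Fin m) :=
    Equiv.prodCongrRight (Function.update (fun _ : Fin D => (1 : Equiv.Perm (Fin m))) r ψ)
  let G : Equiv.Perm (Fin D × Fin m) := C⁻¹ * P * C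
  have hC : ∀ b p, C (b, p) = (b, (Function.update (fun _ : Fin D => (1 : Equiv.Perm (Fin m))) r ψ b) p) :=
    fun b p => Equiv.prodCongrRight_apply _ b p
  have hCr : ∀ p, C (r, p) = (r, ψ p) := fun p => by rw [hC, Function.update_self]
  have hCne : ∀ b p, b ≠ r → C (b, p) = (b, p) := fun b p hb => by
    rw [hC, Function.update_of_ne hb, Equiv.Perm.one_apply]
  have hCinv_r : ∀ p, C⁻¹ (r, p) = (r, ψ.symm p) := fun p => by
    rw [Equiv.Perm.inv_def, Equiv.symm_apply_eq, hCr, Equiv.apply_symm_apply]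
  have hCinv_ne : ∀ b p, b ≠ r → C⁻¹ (b, p) = (b, p) := fun b p hb => by
    rw [Equiv.Perm.inv_def, Equiv.symm_apply_eq, hCne b p hb]
  have hP : ∀ b p, P (b, p) = (Equiv.swap r r' b, p) := fun b p => Equiv.prodCongrLeft_apply _ b p
  have hGr : ∀ p, G (r, p) = (r', ψ p) := by
    intro p
    change C⁻¹ (P (C (r, p))) = _
    rw [hCr, hP, Equiv.swap_apply_left, hCinv_ne _ _ hrr'.symm]
  have hGr' : ∀ p, G (r', p) = (r, ψ.symm p) := by
    intro p
    change C⁻¹ (P (C (r', p))) = _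
    rw [hCne _ _ hrr'.symm, hP, Equiv.swap_apply_right, hCinv_r]
  have hGne : ∀ b p, b ≠ r → b ≠ r' → G (b, p) = (b, p) := by
    intro b p hb hb'
    change C⁻¹ (P (C (b, p))) = _
    rw [hCne _ _ hb, hP, Equiv.swap_apply_of_ne_of_ne hb hb', hCinv_ne _ _ hb]
  have hGfst : ∀ x : Fin D × Fin m, (G x).1 = Equiv.swap r r' x.1 := by
    rintro ⟨b, p⟩
    by_cases hb : b = r
    · subst hb; rw [hGr, Equiv.swap_apply_left]
    by_cases hb' : b = r'
    · subst hb'; rw [hGr', Equiv.swap_apply_right]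
    · rw [hGne b p hb hb', Equiv.swap_apply_of_ne_of_ne hb hb']
  -- on positions
  let g : Equiv.Perm (Fin (D * m)) := finProdFinEquiv.permCongr G
  have hg : ∀ q, g q = finProdFinEquiv (G (finProdFinEquiv.symm q)) := fun q => Equiv.permCongr_apply _ _ _
  have hblk : ∀ q, blockIdx D m (g q) = Equiv.swap r r' (blockIdx D m q) := by
    intro q
    rw [hg, blockIdx, Equiv.symm_apply_apply, hGfst, blockIdx]
  have hgW : g ∈ blockPerms D m := by
    intro q q'
    rw [hblk, hblk]
    exact (Equiv.swap r r').injective.eq_iff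
  have hgC : g ∈ T.colStab := by
    rw [StdFilling.mem_colStab]
    intro q
    obtain ⟨⟨b, p⟩, rfl⟩ := finProdFinEquiv.surjective q
    rw [hg, Equiv.symm_apply_apply]
    by_cases hb : b = r
    · subst hb
      rw [hGr, hψ, hφ]
    by_cases hb' : b = r'
    · subst hb'
      rw [hGr']
      have h := hφ (ψ.symm p)
      rw [← hψ, Equiv.apply_symm_apply] at h
      exact h.symm
    · rw [hGne b p hb hb']
  have hsign : Equiv.Perm.sign g = -1 := by
    have hG : Equiv.Perm.sign G = Equiv.Perm.sign P := by
      change Equiv.Perm.sign (C⁻¹ * P * C) = _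
      rw [map_mul, map_mul, map_inv, mul_right_comm, inv_mul_cancel, one_mul]
    rw [show g = finProdFinEquiv.permCongr G from rfl, Equiv.Perm.sign_permCongr, hG,
      Equiv.Perm.sign_prodCongrLeft, Finset.prod_const, Equiv.Perm.sign_swap hrr',
      Finset.card_univ, Fintype.card_fin, Odd.neg_one_pow hm]
  -- `Σ e_T = Σ (g · e_T) = -Σ e_T`
  set S := blockSymmetrizer k D m (T.polytabloid k hN) with hS
  have hneg : S = -S := by
    conv_lhs => rw [hS, ← blockSymmetrizer_wordPerm k hgW, T.wordPerm_polytabloid_of_mem_colStab hN hgC,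
      hsign, map_smul]
    simp [hS]
  have h2 : (2 : k) • S = 0 := by
    rw [two_smul]
    nth_rewrite 2 [hneg]
    rw [add_neg_cancel]
  exact (smul_eq_zero.1 h2).resolve_left two_ne_zero

/-- **BI 2017 App. Cor. 7.2, the vanishing case, in the word model.** If `|Y| = D m` with fewer
than `N` rows and all cells in columns `< C`, the block size `m` is odd, and `binom(C, m) < D`,
then every `S_D ≀ S_m`-invariant highest-weight vector of weight `Y` in the word model of
`V^{⊗ Dm}` vanishes: `|S_D ≀ S_m| · x = ∑_T a_T Σ e_T` (BIP Prop. 3.3) and every `Σ e_T` is `0` —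
either a column of `T` contains two positions of one block (BIP Lemma 4.3(1)), or the `D` blocks
have `D` column sets among the `binom(C,m)` subsets of size `m` of the columns, two of which
coincide (`blockSymmetrizer_polytabloid_eq_zero_of_colset_eq`). ("there are only `binom(2D,D)`
many cardinality `D` subsets", proof of Prop. 3.24(3), L1393.)
[cite: BurgisserIkenmeyer2017, §7 (Appendix) Cor. 7.2] -/
theorem eq_zero_of_mem_highestWeightSpace_wordRep_of_choose_lt
    (hN : ∀ x ∈ Y.cells, x.1 < N) (hd : Y.cells.card = D * m) (hm : Odd m)
    {C : ℕ} (hC : ∀ x ∈ Y.cells, x.2 < C) (hlt : Nat.choose C m < D)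
    {x : Word N (D * m) → k} (hx : x ∈ highestWeightSpace (wordRep k N (D * m)) (ydWeight N Y))
    (hinv : ∀ τ ∈ blockPerms D m, wordPerm k τ x = x) : x = 0 := by
  classical
  obtain ⟨a, ha⟩ := exists_sum_smul_polytabloid_eq hN hd hx
  have hS : (blockPermsFinset D m).card • x =
      ∑ T, a T • blockSymmetrizer k D m (T.polytabloid k hN) := by
    rw [← blockSymmetrizer_apply_of_forall_wordPerm_eq k hinv, ← ha, map_sum]
    simp_rw [map_smul]
  have hT : ∀ T : StdFilling (D * m) Y, blockSymmetrizer k D m (T.polytabloid k hN) = 0 := by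
    intro T
    by_cases hinj : ∀ p q : Fin (D * m), (T.1 p).2 = (T.1 q).2 → blockIdx D m p = blockIdx D m q → p = q
    · -- the column sets of the blocks: `D` subsets of size `m` of `range C`
      let J : Fin D → Finset ℕ := fun b =>
        Finset.univ.image fun p : Fin m => (T.1 (finProdFinEquiv (b, p))).2
      have hJmem : ∀ b, J b ∈ (Finset.range C).powersetCard m := by
        intro b
        rw [Finset.mem_powersetCard]
        refine ⟨fun c hc => ?_, ?_⟩
        · obtain ⟨p, -, rfl⟩ := Finset.mem_image.mp hc
          exact Finset.mem_range.mpr (hC _ ((YoungDiagram.mem_cells _).mpr (T.mem _)))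
        · rw [Finset.card_image_of_injective _ fun p₁ p₂ h => ?_, Finset.card_univ, Fintype.card_fin]
          have := hinj _ _ h (by rw [blockIdx_finProdFinEquiv, blockIdx_finProdFinEquiv])
          exact (Prod.ext_iff.mp (finProdFinEquiv.injective this)).2
      -- two blocks share a column set
      obtain ⟨r, -, r', -, hrr', hJ⟩ : ∃ r ∈ (Finset.univ : Finset (Fin D)), ∃ r' ∈ (Finset.univ : Finset (Fin D)),
          r ≠ r' ∧ J r = J r' := by
        refine Finset.exists_ne_map_eq_of_card_lt_of_maps_to (t := (Finset.range C).powersetCard m) ?_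
          fun b _ => hJmem b
        rw [Finset.card_powersetCard, Finset.card_range, Finset.card_univ, Fintype.card_fin]
        exact hlt
      refine T.blockSymmetrizer_polytabloid_eq_zero_of_colset_eq hN hm hinj hrr' fun p => ?_
      have hp : (T.1 (finProdFinEquiv (r, p))).2 ∈ J r' := by
        rw [← hJ]
        exact Finset.mem_image.mpr ⟨p, Finset.mem_univ _, rfl⟩
      obtain ⟨p', -, hp'⟩ := Finset.mem_image.mp hp
      exact ⟨p', hp'⟩
    · push Not at hinj
      obtain ⟨p, q, hcol, hblk, hpq⟩ := hinj
      exact T.blockSymmetrizer_polytabloid_eq_zero hN hpq hcol hblk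
  have h0 : (blockPermsFinset D m).card • x = 0 := by
    rw [hS]
    exact Finset.sum_eq_zero fun T _ => by rw [hT T, smul_zero]
  rw [← Nat.cast_smul_eq_nsmul k] at h0
  exact (smul_eq_zero.mp h0).resolve_left (Nat.cast_ne_zero.mpr card_blockPermsFinset_pos.ne')

end WordModel

/-! ### §2 Back to `k[Sym^n]_d`: no highest-weight vectors of dual weight `λ^*` when `n` is odd
and `binom(λ_1, n) < d` -/

section Polynomials

open MvPolynomial

variable {k : Type*} [Field k] [CharZero k] {σ : Type*} [LinearOrder σ] [Fintype σ] {M : ℕ}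
  {n d : ℕ}

/-- **No highest-weight vectors of weight `λ^*` among the forms of degree `d` on `Sym^n (k^σ)`
when `n` is odd and `binom(C, n) < d`**, `C` bounding the columns of `λ` (`λ_1 ≤ C`): for
`ρ : Fin M ≃ σ` order-reversing, `λ ⊢ d·n` with at most `M` parts, `χ` with `-χ(ρ i) = λ_{i+1}`,
every highest-weight vector `h ∈ k[Sym^n]_d` of weight `χ` is `0`: its polarisation
`wordOfForm ρ n d h` is an `S_d ≀ S_n`-invariant highest-weight vector of weight `λ` of the word
model (`wordOfForm_mem_highestWeightSpace`, `wordPerm_wordOfForm`), hence zero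
(`eq_zero_of_mem_highestWeightSpace_wordRep_of_choose_lt`), and the polarisation is injective.
BI 2017 App. Prop. 7.1 / Cor. 7.2 (bound `q_λ(d) = 0`). [cite: BurgisserIkenmeyer2017, §7 (Appendix) Prop. 7.1] -/
theorem eq_zero_of_mem_highestWeightSpace_coordRep_of_choose_lt {ρ : Fin M ≃ σ}
    (hρ : StrictAnti ρ) {s : ℕ} (hs : s = d * n) (lam : Nat.Partition s)
    (hlam : lam.parts.card ≤ M) (hn : Odd n) {C : ℕ} (hC : ∀ x ∈ lam.youngDiagram.cells, x.2 < C)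
    (hlt : Nat.choose C n < d)
    {h : MvPolynomial (DegIdx σ n) k} (hh : h.IsHomogeneous d) {χ : Weight σ}
    (hχ : ∀ i, -χ (ρ i) = Weight.ofPartition M lam i)
    (hhw : h ∈ highestWeightSpace (coordRep σ k n) χ) : h = 0 := by
  classical
  subst hs
  set Y := lam.youngDiagram with hY
  have hN : ∀ x ∈ Y.cells, x.1 < M := fun x hx =>
    Literature.NumberTheory.DiophantineGeometry.fst_lt_of_mem_youngDiagram lam hlam hx
  have hd : Y.cells.card = d * n := lam.card_cells_youngDiagram
  have hx : wordOfForm ρ n d h ∈ highestWeightSpace (wordRep k M (d * n)) (ydWeight M Y) := by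
    have := wordOfForm_mem_highestWeightSpace hρ hh hhw
    rwa [show (fun i => -χ (ρ i)) = ydWeight M Y from by
      rw [hY, Literature.NumberTheory.DiophantineGeometry.ydWeight_youngDiagram]
      funext i
      exact hχ i] at this
  have hinv : ∀ τ ∈ blockPerms d n, wordPerm k τ (wordOfForm ρ n d h) = wordOfForm ρ n d h :=
    fun τ hτ => wordPerm_wordOfForm ρ h hτ
  have hx0 : wordOfForm ρ n d h = 0 :=
    eq_zero_of_mem_highestWeightSpace_wordRep_of_choose_lt hN hd hn hC hlt hx hinv
  refine eq_of_wordOfForm_eq ρ hh (isHomogeneous_zero _ _ _) ?_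
  rw [hx0]
  funext w
  rw [Pi.zero_apply, wordOfForm_apply, polarize, arrOf, coeff_zero, zero_div]

end Polynomials

/-! ### §3 `SL_m`-invariants are highest-weight vectors of rectangular weight; the vanishing case
of App. Cor. 7.2 -/

section Invariants

open MvPolynomial

variable {m D d : ℕ}

/-- **A homogeneous `SL_m`-invariant of degree `d` on `Sym^D ℂ^m` is a highest-weight vector of
`coordRep` of the constant weight `-(Dd/m)`** (`m ≥ 1`, `m ∣ Dd`): an upper triangular `g ∈ GL_m`
is `(s · 1) h` with `h ∈ SL_m`, `s^m = det g` (`exists_eq_scalar_mul_toGL`), `h` fixes `F` and the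
scalar acts by `s^{-Dd} = ∏ g_{ii}^{-Dd/m} = χ(g)`. (BI 2017 Lemma 3.2 / §7: the `SL_m`-invariants
of degree `d` are the isotypic component of type `λ^*`, `λ = ((Dd/m)^m)`.)
[cite: BurgisserIkenmeyer2017, §7 (Appendix) Cor. 7.2 (proof)] -/
theorem slInvariantsOfDegree_le_highestWeightSpace (hm : 0 < m) (hdvd : m ∣ D * d) :
    slInvariantsOfDegree (Fin m) ℂ D d ≤
      highestWeightSpace (coordRep (Fin m) ℂ D) (fun _ : Fin m => -((D * d / m : ℕ) : ℤ)) := by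
  intro F hF
  obtain ⟨hFh, hFi⟩ := (mem_slInvariantsOfDegree_iff D d F).mp hF
  rw [mem_highestWeightSpace_iff]
  intro g hg
  obtain ⟨s, hs, h, hgsh⟩ := exists_eq_scalar_mul_toGL hm g
  -- `det g = s^m`
  have hdet : Matrix.det (g : Matrix (Fin m) (Fin m) ℂ) = s ^ m := by
    rw [hgsh, Matrix.GeneralLinearGroup.coe_mul, Matrix.det_mul,
      Matrix.SpecialLinearGroup.coe_GL_coe_matrix, h.det_coe, mul_one,
      Matrix.GeneralLinearGroup.coe_scalar, Matrix.scalar_apply, Matrix.det_diagonal,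
      Finset.prod_const, Finset.card_univ, Fintype.card_fin, Units.val_mk0]
  -- the action: `g · F = s^{-Dd} F`
  have hact : coordRep (Fin m) ℂ D g F = ((s⁻¹) ^ D) ^ d • F := by
    rw [coordRep_apply, hgsh, coordSubst_scalar_mul_toGL_of_isHomogeneous hs h hFh]
    have := hFi h
    rw [coordRep_apply] at this
    rw [this]
  -- the character: `χ(g) = (det g)^{-(Dd/m)} = s^{-Dd}`
  have hchar : weightChar (fun _ : Fin m => -((D * d / m : ℕ) : ℤ)) g = ((s⁻¹) ^ D) ^ d := by
    rw [weightChar]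
    rw [Finset.prod_congr rfl fun i _ => (zpow_neg ((g : Matrix (Fin m) (Fin m) ℂ) i i) _),
      Finset.prod_inv_distrib]
    simp only [zpow_natCast]
    rw [Finset.prod_pow, ← Matrix.det_of_upperTriangular hg, hdet, ← pow_mul,
      Nat.mul_div_cancel' hdvd, inv_pow, inv_pow, ← pow_mul, ← inv_pow]
  rw [hact, hchar]

/-- **BI 2017 App. Cor. 7.2, the vanishing case: `O(Sym^D ℂ^m)^{SL_m}_d = 0` when `D` is odd,
`m ∣ Dd` and `binom(Dd/m, D) < d`** ("The dimension of the `SL_m`-invariant space in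
`O(Sym^D ℂ^m)_d` is bounded from above by the number of cardinality `d` sets of cardinality `D`
subsets of `{1,…,dD/m}` …", L2897 — here that number is `0`). An invariant is a highest-weight
vector of weight `λ^*`, `λ` the rectangle `m × (Dd/m)` (`slInvariantsOfDegree_le_highestWeightSpace`),
and §2 applies with `C = Dd/m` columns. [cite: BurgisserIkenmeyer2017, §7 (Appendix) Cor. 7.2] -/
theorem slInvariantsOfDegree_eq_bot_of_choose_lt (hm : 0 < m) (hD : Odd D) (hdvd : m ∣ D * d)
    (hlt : Nat.choose (D * d / m) D < d) :
    slInvariantsOfDegree (Fin m) ℂ D d = ⊥ := by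
  classical
  rw [Submodule.eq_bot_iff]
  intro F hF
  obtain ⟨hFh, -⟩ := (mem_slInvariantsOfDegree_iff D d F).mp hF
  have hHW : F ∈ highestWeightSpace (coordRep (Fin m) ℂ D) (fun _ : Fin m => -((D * d / m : ℕ) : ℤ)) :=
    slInvariantsOfDegree_le_highestWeightSpace hm hdvd hF
  have hms : m * (D * d / m) = d * D := by rw [Nat.mul_div_cancel' hdvd, mul_comm]
  have hρ : StrictAnti (Fin.revPerm : Fin m ≃ Fin m) := fun a b hab => Fin.rev_lt_rev.mpr hab
  have hC : ∀ x ∈ (Nat.Partition.rectangle m (D * d / m)).youngDiagram.cells, x.2 < D * d / m :=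
    fun x hx => ((mem_youngDiagram_rectangle_iff m (D * d / m) x).mp ((YoungDiagram.mem_cells _).mp hx)).2
  have hχ : ∀ i : Fin m, -(fun _ : Fin m => -((D * d / m : ℕ) : ℤ)) (Fin.revPerm i) =
      Weight.ofPartition m (Nat.Partition.rectangle m (D * d / m)) i := fun i => by
    rw [Weight.ofPartition_rectangle_apply, neg_neg]
  exact eq_zero_of_mem_highestWeightSpace_coordRep_of_choose_lt hρ hms
    (Nat.Partition.rectangle m (D * d / m)) (Nat.Partition.card_parts_rectangle_le m (D * d / m)) hD hC
    hlt hFh hχ hHW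

end Invariants

/-! ### §4 BI 2017 Prop. 3.24 (3) unconditionally, and the named fact -/

section PropThreeTwentyFour

open MvPolynomial

variable {m D : ℕ}

/-- **No `SL_m`-invariants of degree `2m` on `Sym^D ℂ^m` for `D` odd and `binom(2D, D) < 2m`**
(BI 2017, proof of Prop. 3.24 (3): "There is no nonzero `SL_m`-invariant in degree `2m` if
`binom(2D,D) < 2m` … there are only `binom(2D,D)` many cardinality `D` subsets of `{1,…,2D}`",
L1390–1394). [cite: BurgisserIkenmeyer2017, Prop. 3.24 (3) (proof)] -/
theorem slInvariantsOfDegree_two_mul_eq_bot (hm : 0 < m) (hD : Odd D)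
    (hlt : Nat.choose (2 * D) D < 2 * m) :
    slInvariantsOfDegree (Fin m) ℂ D (2 * m) = ⊥ := by
  refine slInvariantsOfDegree_eq_bot_of_choose_lt hm hD ⟨2 * D, by ring⟩ ?_
  rwa [show D * (2 * m) = 2 * D * m by ring, Nat.mul_div_cancel _ hm]

/-- **BI 2017, Prop. 3.24 (3), PROVED**: for `D ≥ 2` odd, `m ≥ 2` and `binom(2D,D) < 2m`, the
power sum `w = X_1^D + ⋯ + X_m^D` has `e(w) > 2m` and `e'(w) > 1` (`2m ∉ E(w)` since there is no
`SL_m`-invariant of degree `2m` at all, `E(w) ⊆ b(w)ℕ = 2mℕ`, `E(w)` has a positive element by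
Hilbert's nonvanishing `exists_pos_mem_degreeMonoid`, and `e = b e'`).
[cite: BurgisserIkenmeyer2017, Prop. 3.24 (3)] -/
theorem BI2017_prop_3_24_part3 (hD2 : 2 ≤ D) (hm : 2 ≤ m) (hD : Odd D)
    (hlt : Nat.choose (2 * D) D < 2 * m) :
    2 * m < minimalDegree D (∑ i : Fin m, (X i : MvPolynomial (Fin m) ℂ) ^ D) ∧
    1 < minimalExponent D (∑ i : Fin m, (X i : MvPolynomial (Fin m) ℂ) ^ D) := by
  have hD0 : 0 < D := by omega
  have hw : (∑ i : Fin m, (X i : MvPolynomial (Fin m) ℂ) ^ D).IsHomogeneous D :=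
    IsHomogeneous.sum _ _ _ fun i _ => isHomogeneous_X_pow i D
  have hw0 : (∑ i : Fin m, (X i : MvPolynomial (Fin m) ℂ) ^ D) ≠ 0 := by
    intro h
    have h1 := congrArg (coeff (Finsupp.single (⟨0, by omega⟩ : Fin m) D)) h
    rw [coeff_sum, coeff_zero] at h1
    simp only [coeff_X_pow] at h1
    rw [Finset.sum_eq_single (⟨0, by omega⟩ : Fin m), if_pos rfl] at h1
    · exact one_ne_zero h1
    · intro a _ ha
      rw [if_neg]
      intro h2
      exact ha ((Finsupp.single_left_inj (by omega : D ≠ 0)).mp h2)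
    · exact fun h => absurd (Finset.mem_univ _) h
  have hpoly := BI2017_cor_2_9_chow_powerSum_holds.2 m D (by omega)
  have hpos := exists_pos_mem_degreeMonoid (by omega : 0 < m) hw hw0 hpoly
  have hb := degreePeriod_psum_of_odd hD hD2 hm
  have hbot := slInvariantsOfDegree_two_mul_eq_bot (by omega : 0 < m) hD hlt
  -- `2m ∉ E(w)`
  have hnot : 2 * m ∉ degreeMonoid D (∑ i : Fin m, (X i : MvPolynomial (Fin m) ℂ) ^ D) := by
    rintro ⟨F, hFh, hFi, hFI⟩
    have hmem : F ∈ slInvariantsOfDegree (Fin m) ℂ D (2 * m) :=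
      (mem_slInvariantsOfDegree_iff D (2 * m) F).mpr ⟨hFh, hFi⟩
    rw [hbot, Submodule.mem_bot] at hmem
    exact hFI (hmem ▸ Ideal.zero_mem _)
  have hne : ({e | e ∈ degreeMonoid D (∑ i : Fin m, (X i : MvPolynomial (Fin m) ℂ) ^ D) ∧ 0 < e} :
      Set ℕ).Nonempty := by
    obtain ⟨e, he, he0⟩ := hpos
    exact ⟨e, he, he0⟩
  have hmin := Nat.sInf_mem hne
  have he : 2 * m < minimalDegree D (∑ i : Fin m, (X i : MvPolynomial (Fin m) ℂ) ^ D) := by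
    rw [minimalDegree]
    have hdvd := degreePeriod_dvd_of_mem_degreeMonoid hD2 hw hw0 hpoly hmin.1
    rw [hb] at hdvd
    obtain ⟨e, he⟩ := hdvd
    have he0 : e ≠ 0 := by
      rintro rfl
      exact absurd hmin.2 (by rw [he, mul_zero]; exact lt_irrefl 0)
    have he1 : e ≠ 1 := by
      rintro rfl
      rw [mul_one] at he
      exact hnot (he ▸ hmin.1)
    rw [he]
    have : 2 ≤ e := by omega
    nlinarith
  refine ⟨he, ?_⟩
  have h323 := (BI2017_lem_3_2_3_holds m D _ hD2 hw hw0 hpoly).2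
  rw [hb] at h323
  rw [h323] at he
  by_contra hle
  rw [not_lt] at hle
  have : 2 * m * minimalExponent D (∑ i : Fin m, (X i : MvPolynomial (Fin m) ℂ) ^ D) ≤ 2 * m * 1 :=
    Nat.mul_le_mul_left _ hle
  omega

/-- **BI 2017, Prop. 3.24 — the named fact `BI2017_prop_3_24` holds** ("Let
`w = X_1^D + ⋯ + X_m^D`. 1. If `D` is even, then `w` has the degree period `b(w) = m` and minimal
degree `e(w) = m`. 2. If `D` is odd, then `w` has the degree period `b(w) = 2m`. If additionally
`2m ≤ binom(2D,D)`, then we have `e(w) = 2m`. 3. If `D` is odd and `2m > binom(2D,D)`, we have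
`e(w) > 2m`. In the cases 1 and 2, we have `e'(w) = 1`. In case 3, we have `e'(w) > 1`."; `D ≥ 2`,
`m ≥ 2`). Parts 1–2: `BI17PowerSumDegreeProofs.lean`; part 3: this file.
[cite: BurgisserIkenmeyer2017, Prop. 3.24] -/
theorem BI2017_prop_3_24_holds : BI2017_prop_3_24 := by
  intro D m hD2 hm
  exact ⟨fun hD => BI2017_prop_3_24_part1 hD2 hm hD, fun hD => BI2017_prop_3_24_part2 hD2 hm hD,
    fun hD hlt => BI2017_prop_3_24_part3 hD2 hm hD hlt⟩

end PropThreeTwentyFour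

end Literature.Computability.AlgebraicComplexity

end
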